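import Summits.MatrixMultiplication.OmegaCensus.DihedralLawModOneZ7Z7Orders
import HarnessLib

/-!
# Instances of the `ℤ_7²`-quotient law exclusions: `ℤ₇ × ℤ₂₈`, `ℤ₁₄ × ℤ₁₄`, `ℤ₇ × ℤ₄₉`, `ℤ₇ × ℤ₉₁`, `ℤ₇ × ℤ₁₃₃`, `ℤ₇³`

ω-census `pub-omega`, family (b3), seat pub-omega-group gen 38.  Framing: lottery ticket; floor = certified bounds/negative ranges.
VALUE: named kernel instances of `no_mod_one_law_card_N_of_onto_z7z7` (`DihedralLawModOneZ7Z7Orders.lean`) for the census lines `|A| = 196, 343, 637, 931`: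
no dihedral-like group over these abelian groups (any `c₀`) has a TPP triple with `3|S||T||U| + 8 = 8|A|`; NOT progress on ω.
-/

namespace Summit.MatrixMultiplication.OmegaCensus

open Literature.Combinatorics.Additive Finset

section Instances

variable {G : Type} [Group G] [DecidableEq G] {S T U : Finset G}

/-- Every element of `ℤ₇ × ℤ₂₈ (≅ ℤ₄ × ℤ₇²)` has order `≤ 28 < |A|/2`. [folklore] -/
theorem two_mul_addOrderOf_lt_z7_z28 (g : ZMod 7 × ZMod 28) : 2 * addOrderOf g < Fintype.card (ZMod 7 × ZMod 28) := by
  have h1 : addOrderOf g.1 ∣ 28 := (addOrderOf_dvd_card (x := g.1)).trans (by rw [ZMod.card]; norm_num)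
  have h2 : addOrderOf g.2 ∣ 28 := (addOrderOf_dvd_card (x := g.2)).trans (by rw [ZMod.card])
  have hle : addOrderOf g ≤ 28 := Nat.le_of_dvd (by norm_num) (by rw [Prod.addOrderOf]; exact Nat.lcm_dvd h1 h2)
  have hA : Fintype.card (ZMod 7 × ZMod 28) = 196 := by simp [Fintype.card_prod, ZMod.card]
  omega

/-- **`ℤ₇ × ℤ₂₈ (≅ ℤ₄ × ℤ₇²)` (`|A| = 196`): no dihedral-like group over it (any `c₀`) has a TPP triple attaining `3|S||T||U| + 8 = 8|A|`.** [folklore] -/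
theorem no_mod_one_law_z7_z28 {ρ τ : ZMod 7 × ZMod 28 → G} {c₀ : ZMod 7 × ZMod 28}
    (hρρ : ∀ a b, ρ a * ρ b = ρ (a + b)) (hρτ : ∀ a b, ρ a * τ b = τ (b - a))
    (hτρ : ∀ a b, τ a * ρ b = τ (a + b)) (hττ : ∀ a b, τ a * τ b = ρ (c₀ + b - a))
    (hρ : Function.Injective ρ) (hτ : Function.Injective τ) (hne : ∀ a b, ρ a ≠ τ b)
    (hsurj : ∀ g, (∃ a, ρ a = g) ∨ (∃ a, τ a = g)) (h : TripleProductProperty S T U) :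
    3 * (S.card * T.card * U.card) + 8 ≠ 8 * Fintype.card (ZMod 7 × ZMod 28) := by
  refine no_mod_one_law_card_196_of_onto_z7z7 (by simp [Fintype.card_prod, ZMod.card]) two_mul_addOrderOf_lt_z7_z28
    hρρ hρτ hτρ hττ hρ hτ hne hsurj
    ((AddMonoidHom.id (ZMod 7)).prodMap (ZMod.castHom (show 7 ∣ 28 by norm_num) (ZMod 7)).toAddMonoidHom) ?_ h
  intro q
  obtain ⟨b, hb⟩ := ZMod.castHom_surjective (show 7 ∣ 28 by norm_num) (n := 28) q.2
  exact ⟨(q.1, b), Prod.ext rfl hb⟩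

/-- Every element of `ℤ₁₄ × ℤ₁₄ (≅ ℤ₂² × ℤ₇²)` has order `≤ 14 < |A|/2`. [folklore] -/
theorem two_mul_addOrderOf_lt_z14_z14 (g : ZMod 14 × ZMod 14) : 2 * addOrderOf g < Fintype.card (ZMod 14 × ZMod 14) := by
  have h1 : addOrderOf g.1 ∣ 14 := (addOrderOf_dvd_card (x := g.1)).trans (by rw [ZMod.card])
  have h2 : addOrderOf g.2 ∣ 14 := (addOrderOf_dvd_card (x := g.2)).trans (by rw [ZMod.card])
  have hle : addOrderOf g ≤ 14 := Nat.le_of_dvd (by norm_num) (by rw [Prod.addOrderOf]; exact Nat.lcm_dvd h1 h2)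
  have hA : Fintype.card (ZMod 14 × ZMod 14) = 196 := by simp [Fintype.card_prod, ZMod.card]
  omega

/-- **`ℤ₁₄ × ℤ₁₄ (≅ ℤ₂² × ℤ₇²)` (`|A| = 196`): no dihedral-like group over it (any `c₀`) has a TPP triple attaining `3|S||T||U| + 8 = 8|A|`.** [folklore] -/
theorem no_mod_one_law_z14_z14 {ρ τ : ZMod 14 × ZMod 14 → G} {c₀ : ZMod 14 × ZMod 14}
    (hρρ : ∀ a b, ρ a * ρ b = ρ (a + b)) (hρτ : ∀ a b, ρ a * τ b = τ (b - a))
    (hτρ : ∀ a b, τ a * ρ b = τ (a + b)) (hττ : ∀ a b, τ a * τ b = ρ (c₀ + b - a))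
    (hρ : Function.Injective ρ) (hτ : Function.Injective τ) (hne : ∀ a b, ρ a ≠ τ b)
    (hsurj : ∀ g, (∃ a, ρ a = g) ∨ (∃ a, τ a = g)) (h : TripleProductProperty S T U) :
    3 * (S.card * T.card * U.card) + 8 ≠ 8 * Fintype.card (ZMod 14 × ZMod 14) := by
  refine no_mod_one_law_card_196_of_onto_z7z7 (by simp [Fintype.card_prod, ZMod.card]) two_mul_addOrderOf_lt_z14_z14
    hρρ hρτ hτρ hττ hρ hτ hne hsurj
    ((ZMod.castHom (show 7 ∣ 14 by norm_num) (ZMod 7)).toAddMonoidHom.prodMap (ZMod.castHom (show 7 ∣ 14 by norm_num) (ZMod 7)).toAddMonoidHom) ?_ h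
  intro q
  obtain ⟨a, ha⟩ := ZMod.castHom_surjective (show 7 ∣ 14 by norm_num) (n := 14) q.1
  obtain ⟨b, hb⟩ := ZMod.castHom_surjective (show 7 ∣ 14 by norm_num) (n := 14) q.2
  exact ⟨(a, b), Prod.ext ha hb⟩

/-- Every element of `ℤ₇ × ℤ₄₉` has order `≤ 49 < |A|/2`. [folklore] -/
theorem two_mul_addOrderOf_lt_z7_z49 (g : ZMod 7 × ZMod 49) : 2 * addOrderOf g < Fintype.card (ZMod 7 × ZMod 49) := by
  have h1 : addOrderOf g.1 ∣ 49 := (addOrderOf_dvd_card (x := g.1)).trans (by rw [ZMod.card]; norm_num)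
  have h2 : addOrderOf g.2 ∣ 49 := (addOrderOf_dvd_card (x := g.2)).trans (by rw [ZMod.card])
  have hle : addOrderOf g ≤ 49 := Nat.le_of_dvd (by norm_num) (by rw [Prod.addOrderOf]; exact Nat.lcm_dvd h1 h2)
  have hA : Fintype.card (ZMod 7 × ZMod 49) = 343 := by simp [Fintype.card_prod, ZMod.card]
  omega

/-- **`ℤ₇ × ℤ₄₉` (`|A| = 343`): no dihedral-like group over it (any `c₀`) has a TPP triple attaining `3|S||T||U| + 8 = 8|A|`.** [folklore] -/
theorem no_mod_one_law_z7_z49 {ρ τ : ZMod 7 × ZMod 49 → G} {c₀ : ZMod 7 × ZMod 49}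
    (hρρ : ∀ a b, ρ a * ρ b = ρ (a + b)) (hρτ : ∀ a b, ρ a * τ b = τ (b - a))
    (hτρ : ∀ a b, τ a * ρ b = τ (a + b)) (hττ : ∀ a b, τ a * τ b = ρ (c₀ + b - a))
    (hρ : Function.Injective ρ) (hτ : Function.Injective τ) (hne : ∀ a b, ρ a ≠ τ b)
    (hsurj : ∀ g, (∃ a, ρ a = g) ∨ (∃ a, τ a = g)) (h : TripleProductProperty S T U) :
    3 * (S.card * T.card * U.card) + 8 ≠ 8 * Fintype.card (ZMod 7 × ZMod 49) := by
  refine no_mod_one_law_card_343_of_onto_z7z7 (by simp [Fintype.card_prod, ZMod.card]) two_mul_addOrderOf_lt_z7_z49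
    hρρ hρτ hτρ hττ hρ hτ hne hsurj
    ((AddMonoidHom.id (ZMod 7)).prodMap (ZMod.castHom (show 7 ∣ 49 by norm_num) (ZMod 7)).toAddMonoidHom) ?_ h
  intro q
  obtain ⟨b, hb⟩ := ZMod.castHom_surjective (show 7 ∣ 49 by norm_num) (n := 49) q.2
  exact ⟨(q.1, b), Prod.ext rfl hb⟩

/-- Every element of `ℤ₇ × ℤ₉₁ (the non-cyclic abelian group of order 637)` has order `≤ 91 < |A|/2`. [folklore] -/
theorem two_mul_addOrderOf_lt_z7_z91 (g : ZMod 7 × ZMod 91) : 2 * addOrderOf g < Fintype.card (ZMod 7 × ZMod 91) := by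
  have h1 : addOrderOf g.1 ∣ 91 := (addOrderOf_dvd_card (x := g.1)).trans (by rw [ZMod.card]; norm_num)
  have h2 : addOrderOf g.2 ∣ 91 := (addOrderOf_dvd_card (x := g.2)).trans (by rw [ZMod.card])
  have hle : addOrderOf g ≤ 91 := Nat.le_of_dvd (by norm_num) (by rw [Prod.addOrderOf]; exact Nat.lcm_dvd h1 h2)
  have hA : Fintype.card (ZMod 7 × ZMod 91) = 637 := by simp [Fintype.card_prod, ZMod.card]
  omega

/-- **`ℤ₇ × ℤ₉₁ (the non-cyclic abelian group of order 637)` (`|A| = 637`): no dihedral-like group over it (any `c₀`) has a TPP triple attaining `3|S||T||U| + 8 = 8|A|`.** [folklore] -/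
theorem no_mod_one_law_z7_z91 {ρ τ : ZMod 7 × ZMod 91 → G} {c₀ : ZMod 7 × ZMod 91}
    (hρρ : ∀ a b, ρ a * ρ b = ρ (a + b)) (hρτ : ∀ a b, ρ a * τ b = τ (b - a))
    (hτρ : ∀ a b, τ a * ρ b = τ (a + b)) (hττ : ∀ a b, τ a * τ b = ρ (c₀ + b - a))
    (hρ : Function.Injective ρ) (hτ : Function.Injective τ) (hne : ∀ a b, ρ a ≠ τ b)
    (hsurj : ∀ g, (∃ a, ρ a = g) ∨ (∃ a, τ a = g)) (h : TripleProductProperty S T U) :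
    3 * (S.card * T.card * U.card) + 8 ≠ 8 * Fintype.card (ZMod 7 × ZMod 91) := by
  refine no_mod_one_law_card_637_of_onto_z7z7 (by simp [Fintype.card_prod, ZMod.card]) two_mul_addOrderOf_lt_z7_z91
    hρρ hρτ hτρ hττ hρ hτ hne hsurj
    ((AddMonoidHom.id (ZMod 7)).prodMap (ZMod.castHom (show 7 ∣ 91 by norm_num) (ZMod 7)).toAddMonoidHom) ?_ h
  intro q
  obtain ⟨b, hb⟩ := ZMod.castHom_surjective (show 7 ∣ 91 by norm_num) (n := 91) q.2
  exact ⟨(q.1, b), Prod.ext rfl hb⟩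

/-- Every element of `ℤ₇ × ℤ₁₃₃ (the non-cyclic abelian group of order 931)` has order `≤ 133 < |A|/2`. [folklore] -/
theorem two_mul_addOrderOf_lt_z7_z133 (g : ZMod 7 × ZMod 133) : 2 * addOrderOf g < Fintype.card (ZMod 7 × ZMod 133) := by
  have h1 : addOrderOf g.1 ∣ 133 := (addOrderOf_dvd_card (x := g.1)).trans (by rw [ZMod.card]; norm_num)
  have h2 : addOrderOf g.2 ∣ 133 := (addOrderOf_dvd_card (x := g.2)).trans (by rw [ZMod.card])
  have hle : addOrderOf g ≤ 133 := Nat.le_of_dvd (by norm_num) (by rw [Prod.addOrderOf]; exact Nat.lcm_dvd h1 h2)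
  have hA : Fintype.card (ZMod 7 × ZMod 133) = 931 := by simp [Fintype.card_prod, ZMod.card]
  omega

/-- **`ℤ₇ × ℤ₁₃₃ (the non-cyclic abelian group of order 931)` (`|A| = 931`): no dihedral-like group over it (any `c₀`) has a TPP triple attaining `3|S||T||U| + 8 = 8|A|`.** [folklore] -/
theorem no_mod_one_law_z7_z133 {ρ τ : ZMod 7 × ZMod 133 → G} {c₀ : ZMod 7 × ZMod 133}
    (hρρ : ∀ a b, ρ a * ρ b = ρ (a + b)) (hρτ : ∀ a b, ρ a * τ b = τ (b - a))
    (hτρ : ∀ a b, τ a * ρ b = τ (a + b)) (hττ : ∀ a b, τ a * τ b = ρ (c₀ + b - a))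
    (hρ : Function.Injective ρ) (hτ : Function.Injective τ) (hne : ∀ a b, ρ a ≠ τ b)
    (hsurj : ∀ g, (∃ a, ρ a = g) ∨ (∃ a, τ a = g)) (h : TripleProductProperty S T U) :
    3 * (S.card * T.card * U.card) + 8 ≠ 8 * Fintype.card (ZMod 7 × ZMod 133) := by
  refine no_mod_one_law_card_931_of_onto_z7z7 (by simp [Fintype.card_prod, ZMod.card]) two_mul_addOrderOf_lt_z7_z133
    hρρ hρτ hτρ hττ hρ hτ hne hsurj
    ((AddMonoidHom.id (ZMod 7)).prodMap (ZMod.castHom (show 7 ∣ 133 by norm_num) (ZMod 7)).toAddMonoidHom) ?_ h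
  intro q
  obtain ⟨b, hb⟩ := ZMod.castHom_surjective (show 7 ∣ 133 by norm_num) (n := 133) q.2
  exact ⟨(q.1, b), Prod.ext rfl hb⟩

/-- Every element of `ℤ₇ × ℤ₇ × ℤ₇` has order `≤ 49 < |A|/2`. [folklore] -/
theorem two_mul_addOrderOf_lt_z7_z7_z7 (g : ZMod 7 × ZMod 7 × ZMod 7) : 2 * addOrderOf g < Fintype.card (ZMod 7 × ZMod 7 × ZMod 7) := by
  have h1 : addOrderOf g.1 ∣ 49 := (addOrderOf_dvd_card (x := g.1)).trans (by rw [ZMod.card]; norm_num)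
  have h2 : addOrderOf g.2 ∣ 49 := (addOrderOf_dvd_card (x := g.2)).trans (by simp [Fintype.card_prod, ZMod.card])
  have hle : addOrderOf g ≤ 49 := Nat.le_of_dvd (by norm_num) (by rw [Prod.addOrderOf]; exact Nat.lcm_dvd h1 h2)
  have hA : Fintype.card (ZMod 7 × ZMod 7 × ZMod 7) = 343 := by simp [Fintype.card_prod, ZMod.card]
  omega

/-- **`ℤ₇ × ℤ₇ × ℤ₇` (`|A| = 343`): no dihedral-like group over it (any `c₀`) has a TPP triple attaining `3|S||T||U| + 8 = 8|A|`.** [folklore] -/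
theorem no_mod_one_law_z7_z7_z7 {ρ τ : ZMod 7 × ZMod 7 × ZMod 7 → G} {c₀ : ZMod 7 × ZMod 7 × ZMod 7}
    (hρρ : ∀ a b, ρ a * ρ b = ρ (a + b)) (hρτ : ∀ a b, ρ a * τ b = τ (b - a))
    (hτρ : ∀ a b, τ a * ρ b = τ (a + b)) (hττ : ∀ a b, τ a * τ b = ρ (c₀ + b - a))
    (hρ : Function.Injective ρ) (hτ : Function.Injective τ) (hne : ∀ a b, ρ a ≠ τ b)
    (hsurj : ∀ g, (∃ a, ρ a = g) ∨ (∃ a, τ a = g)) (h : TripleProductProperty S T U) :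
    3 * (S.card * T.card * U.card) + 8 ≠ 8 * Fintype.card (ZMod 7 × ZMod 7 × ZMod 7) := by
  refine no_mod_one_law_card_343_of_onto_z7z7 (by simp [Fintype.card_prod, ZMod.card]) two_mul_addOrderOf_lt_z7_z7_z7
    hρρ hρτ hτρ hττ hρ hτ hne hsurj
    ((AddMonoidHom.id (ZMod 7)).prodMap (AddMonoidHom.fst (ZMod 7) (ZMod 7))) ?_ h
  exact fun q => ⟨(q.1, (q.2, 0)), Prod.ext rfl rfl⟩

end Instances

end Summit.MatrixMultiplication.OmegaCensus
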